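import Literature.Analysis.OperatorTheory.TwistedKernelFluxSectors
import Literature.Analysis.OperatorTheory.SpectralSumDecayRate
import HarnessLib

/-!
# 't Hooft's flux energies of a transfer operator: the zero-temperature limit of the flux free energies

Topic `Literature/Analysis/OperatorTheory`; sequel of `TwistedKernelFluxSectors.lean` (the ELECTRIC-FLUX SECTORS
`z_ψ(M+2) = |Γ|⁻¹ Σ_k conj ψ(k) z k (M+2) = Σᵢ λᵢ^M qᵢ(ψ)`, `qᵢ(ψ) = ‖P_ψ κbᵢ‖² ≥ 0`, of a bounded symmetric kernel
with an eigenbasis under a finite abelian group `Γ` of measure-preserving twists; vocabulary of that file and of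
`TwistedKernelTraceFormula.lean`) and of `SpectralSumDecayRate.lean` (decay rate of a positive spectral sum =
its spectral top).  Theorem-only; no definitions, no named facts.

AS PRINTED.  G. 't Hooft, Nucl. Phys. B 153 (1979) 141, §5: `e^{−βF(e)} = Tr P(e) e^{−βH}` ((5.1)–(5.3)); after
(5.4): "In the limit `β → ∞` (or `T → 0`), `F` becomes the energy of the lowest state with the given flux
configuration" (reprint C. Rebbi (ed.), *Lattice Gauge Theories and Monte Carlo Simulations* (1983) p. 553);
J. Greensite, *An Introduction to the Confinement Problem* (2011) §4.4 (4.41)–(4.44) (electric free energy as the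
centre Fourier transform of the twisted partition functions).  On the lattice the inverse temperature is the period
`M + 2` of the transfer-matrix trace and `e^{−E} = Λ_ψ/λ_{i₀}` with

  `Λ_ψ := ⨆ {λᵢ : qᵢ(ψ) ≠ 0}` — the **top of the flux sector** `ψ` (written out; `λ_{i₀} = ‖A‖` the vacuum level).

PROVED (hypotheses as in the companion files; `hz` = the twisted cyclic kernel integrals `z k (M+2) = Tr(Ω[k] 𝕋^{M+2})`):

* `hasSum_re_fluxSector` — the sector trace formula in real form: `HasSum (λᵢ^M · qᵢ(ψ)) (Re z_ψ(M+2))`;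
* `re_fluxSector_succ_le_fluxTop_mul`, `re_fluxSector_le_fluxTop_pow_mul` — **sharp sector decay**
  `z_ψ(M+3) ≤ Λ_ψ · z_ψ(M+2)`, `z_ψ(M+2) ≤ Λ_ψ^M · z_ψ(2)` (for EVERY `ψ`, including `ψ = 0`);
* `fluxTop_le_top` (`Λ_ψ ≤ λ_{i₀}`), `fluxTop_zero_eq` (`Λ_0 = λ_{i₀}`: the vacuum tops the flux-free sector),
  `fluxTop_le_of_ne_zero` (`ψ ≠ 0`, `λᵢ ≤ Λ` off the top `⇒ Λ_ψ ≤ Λ`: the sharpening behind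
  `re_fluxSector_le_pow_mul` of the companion file);
* `exists_fluxCoeff_ne_zero_of_pos` ∕ `re_fluxSector_pos` — the sector is NON-DEGENERATE (`∃ i, qᵢ(ψ) ≠ 0 ∧ λᵢ > 0`)
  iff `z_ψ(3) > 0`, and then `z_ψ(M+2) > 0` for all `M`; `re_fluxSector_zero_pos` (the flux-free sector always is);
* ★ `tendsto_log_re_fluxSector_div` — **'t Hooft's limit**: `log z_ψ(M+2) / M → log Λ_ψ` (the flux free energy per
  unit Euclidean time converges to the energy `−log Λ_ψ` of the lowest state in the sector);
* ★ `tendsto_log_fluxSector_ratio_div` — normalised to the vacuum: `log (z_0(M+2)/z_ψ(M+2)) / M → log λ_{i₀} − log Λ_ψ =: E_ψ ≥ 0`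
  (`fluxEnergy_nonneg`), with `E_ψ ≥ log λ_{i₀} − log Λ > 0` for `ψ ≠ 0` under a gap `λᵢ ≤ Λ < λ_{i₀}` off the top
  (`log_top_sub_log_le_fluxEnergy`);
* ★ `tendsto_fluxEffectiveEnergy`, `fluxEffectiveEnergy_succ_le`, `neg_log_fluxTop_le_fluxEffectiveEnergy` — the
  EFFECTIVE flux energies `log (z_ψ(M+2)/z_ψ(M+3))` decrease to `−log Λ_ψ` (Michael 1997 §2 (3) in each flux channel).

HONEST FRAMING: one finite box (one positive kernel); `Λ_ψ`, `E_ψ` are finite-volume energy levels of that box.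
Nothing here is about the behaviour of `E_ψ` as the box grows ('t Hooft §7: light versus heavy fluxes), duality
(6.3), or a mass gap.

References: 't Hooft 1979 §5; Greensite 2011 §4.4; C. Michael, *Hadronic physics from the lattice* (1997) §2 (2)–(3);
M. Reed, B. Simon IV (1978) Thm XIII.43–44 (Perron–Frobenius top state).
-/

noncomputable section

namespace Literature.Analysis.OperatorTheory

open MeasureTheory Filter Set Function Finset Topology
open scoped RealInnerProductSpace ENNReal ComplexConjugate BigOperators

section FluxEnergy

variable {X : Type*} [MeasurableSpace X] {μ : Measure X} [IsFiniteMeasure μ]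
  {K : X → X → ℝ} {C : ℝ} {A : Lp ℝ 2 μ →L[ℝ] Lp ℝ 2 μ} {ι : Type*}
  {b : HilbertBasis ι ℝ (Lp ℝ 2 μ)} {lam : ι → ℝ}
  {Γ : Type*} [AddCommGroup Γ] [Fintype Γ] {T : Γ → X → X}

/-! ### The sector trace formula in real form -/

/-- **Real form of the flux-sector trace formula**: `Re z_ψ(M+2) = Σᵢ λᵢ^M · Re qᵢ(ψ)` (`HasSum`), the shape of a
positive spectral sum (`SpectralSumDecayRate.lean`). [cite: tHooft1979Flux, §5 (5.1)–(5.3)] -/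
theorem hasSum_re_fluxSector [Countable ι] (hK : StronglyMeasurable (uncurry K)) (hC : ∀ x y, ‖K x y‖ ≤ C)
    (hsymm : ∀ x y, K x y = K y x)
    (hA : ∀ φ : Lp ℝ 2 μ, (A φ : X → ℝ) =ᵐ[μ] fun x => ∫ y, K x y * φ y ∂μ)
    (hb : ∀ i, A (b i) = lam i • b i) (hT : ∀ k, MeasurePreserving (T k) μ μ) {z : Γ → ℕ → ℝ}
    (hz : ∀ k M, z k (M + 2) =
      ∫ x, ((fun f : X → ℝ => fun w => ∫ y, K w y * f y ∂μ)^[M + 1] (fun y => K y x)) (T k x) ∂μ)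
    (ψ : AddChar Γ ℂ) (M : ℕ) :
    HasSum (fun i => lam i ^ M * ((Fintype.card Γ : ℂ)⁻¹ * ∑ k, conj (ψ k) *
        ((∫ x, (∫ z, K (T k x) z * b i z ∂μ) * (∫ z, K x z * b i z ∂μ) ∂μ : ℝ) : ℂ)).re)
      ((Fintype.card Γ : ℂ)⁻¹ * ∑ k, conj (ψ k) * (z k (M + 2) : ℂ)).re := by
  have h := Complex.hasSum_re (hasSum_fluxSector hK hC hsymm hA hb hT hz ψ M)
  refine h.congr_fun fun i => ?_
  show _ = (((lam i ^ M : ℝ) : ℂ) * _).re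
  rw [Complex.re_ofReal_mul]

omit [IsFiniteMeasure μ] in
/-- The levels are bounded by the operator norm: `λᵢ ≤ ‖A‖`. [cite: ReedSimonIV1978, Thm XIII.43 and Thm XIII.44] -/
theorem lam_le_norm (hb : ∀ i, A (b i) = lam i • b i) (i : ι) : lam i ≤ ‖A‖ :=
  (le_abs_self _).trans (abs_lam_le_norm hb i)

omit [IsFiniteMeasure μ] in
/-- The levels are bounded by the top one: `λᵢ ≤ λ_{i₀} = ‖A‖`. [cite: ReedSimonIV1978, Thm XIII.43 and Thm XIII.44] -/
theorem lam_le_top (hb : ∀ i, A (b i) = lam i • b i) {i₀ : ι} (hi₀ : lam i₀ = ‖A‖) (i : ι) : lam i ≤ lam i₀ :=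
  hi₀ ▸ lam_le_norm hb i

/-! ### Sharp sector decay -/

/-- **Sharp one-step sector decay**: `z_ψ(M+3) ≤ Λ_ψ · z_ψ(M+2)` for EVERY character `ψ`, where
`Λ_ψ = ⨆ {λᵢ : qᵢ(ψ) ≠ 0}` is the top of the sector. [cite: tHooft1979Flux, §5 after (5.4)] -/
theorem re_fluxSector_succ_le_fluxTop_mul [Countable ι] (hK : StronglyMeasurable (uncurry K))
    (hC : ∀ x y, ‖K x y‖ ≤ C) (hsymm : ∀ x y, K x y = K y x)
    (hA : ∀ φ : Lp ℝ 2 μ, (A φ : X → ℝ) =ᵐ[μ] fun x => ∫ y, K x y * φ y ∂μ)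
    (hb : ∀ i, A (b i) = lam i • b i) (hlam : ∀ i, 0 ≤ lam i) (hT : ∀ k, MeasurePreserving (T k) μ μ)
    (hT0 : T 0 = id) (hTadd : ∀ k k' x, T (k + k') x = T k (T k' x)) {z : Γ → ℕ → ℝ}
    (hz : ∀ k M, z k (M + 2) =
      ∫ x, ((fun f : X → ℝ => fun w => ∫ y, K w y * f y ∂μ)^[M + 1] (fun y => K y x)) (T k x) ∂μ)
    (ψ : AddChar Γ ℂ) (M : ℕ) :
    ((Fintype.card Γ : ℂ)⁻¹ * ∑ k, conj (ψ k) * (z k (M + 1 + 2) : ℂ)).re ≤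
      (⨆ i : {i // ((Fintype.card Γ : ℂ)⁻¹ * ∑ k, conj (ψ k) *
          ((∫ x, (∫ z, K (T k x) z * b i z ∂μ) * (∫ z, K x z * b i z ∂μ) ∂μ : ℝ) : ℂ)).re ≠ 0}, lam i) *
        ((Fintype.card Γ : ℂ)⁻¹ * ∑ k, conj (ψ k) * (z k (M + 2) : ℂ)).re :=
  spectralSum_succ_le (S := fun M => ((Fintype.card Γ : ℂ)⁻¹ * ∑ k, conj (ψ k) * (z k (M + 2) : ℂ)).re)
    hlam (lam_le_norm hb) (fun i => (fluxCoeff_nonneg (b := b) hK hC hT hT0 hTadd i ψ).1)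
    (hasSum_re_fluxSector hK hC hsymm hA hb hT hz ψ) M

/-- **Sharp sector decay over `M` steps**: `z_ψ(M+2) ≤ Λ_ψ^M · z_ψ(2)` — at inverse temperature `M + 2` the flux
free energy satisfies `e^{−βF_ψ} ≤ Λ_ψ^M z_ψ(2)`, `−log Λ_ψ` being the energy of the lowest state of the sector
(valid for every `ψ`; for `ψ ≠ 0` under a gap this sharpens `re_fluxSector_le_pow_mul`).
[cite: tHooft1979Flux, §5 after (5.4)] -/
theorem re_fluxSector_le_fluxTop_pow_mul [Countable ι] (hK : StronglyMeasurable (uncurry K))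
    (hC : ∀ x y, ‖K x y‖ ≤ C) (hsymm : ∀ x y, K x y = K y x)
    (hA : ∀ φ : Lp ℝ 2 μ, (A φ : X → ℝ) =ᵐ[μ] fun x => ∫ y, K x y * φ y ∂μ)
    (hb : ∀ i, A (b i) = lam i • b i) (hlam : ∀ i, 0 ≤ lam i) (hT : ∀ k, MeasurePreserving (T k) μ μ)
    (hT0 : T 0 = id) (hTadd : ∀ k k' x, T (k + k') x = T k (T k' x)) {z : Γ → ℕ → ℝ}
    (hz : ∀ k M, z k (M + 2) =
      ∫ x, ((fun f : X → ℝ => fun w => ∫ y, K w y * f y ∂μ)^[M + 1] (fun y => K y x)) (T k x) ∂μ)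
    (ψ : AddChar Γ ℂ) (M : ℕ) :
    ((Fintype.card Γ : ℂ)⁻¹ * ∑ k, conj (ψ k) * (z k (M + 2) : ℂ)).re ≤
      (⨆ i : {i // ((Fintype.card Γ : ℂ)⁻¹ * ∑ k, conj (ψ k) *
          ((∫ x, (∫ z, K (T k x) z * b i z ∂μ) * (∫ z, K x z * b i z ∂μ) ∂μ : ℝ) : ℂ)).re ≠ 0}, lam i) ^ M *
        ((Fintype.card Γ : ℂ)⁻¹ * ∑ k, conj (ψ k) * (z k 2 : ℂ)).re :=
  spectralSum_le_spectralTop_pow_mul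
    (S := fun M => ((Fintype.card Γ : ℂ)⁻¹ * ∑ k, conj (ψ k) * (z k (M + 2) : ℂ)).re)
    hlam (lam_le_norm hb) (fun i => (fluxCoeff_nonneg (b := b) hK hC hT hT0 hTadd i ψ).1)
    (hasSum_re_fluxSector hK hC hsymm hA hb hT hz ψ) M

/-! ### Where the sector tops sit -/

omit [IsFiniteMeasure μ] in
/-- Every sector top is below the vacuum level: `Λ_ψ ≤ λ_{i₀}` (so every flux energy is `≥ 0`).
[cite: tHooft1979Flux, §5 (5.1)–(5.4)] [cite: ReedSimonIV1978, Thm XIII.43 and Thm XIII.44] -/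
theorem fluxTop_le_top (hb : ∀ i, A (b i) = lam i • b i) {i₀ : ι} (hi₀ : lam i₀ = ‖A‖) (ψ : AddChar Γ ℂ) :
    (⨆ i : {i // ((Fintype.card Γ : ℂ)⁻¹ * ∑ k, conj (ψ k) *
        ((∫ x, (∫ z, K (T k x) z * b i z ∂μ) * (∫ z, K x z * b i z ∂μ) ∂μ : ℝ) : ℂ)).re ≠ 0}, lam i) ≤ lam i₀ :=
  spectralTop_le (hi₀ ▸ norm_nonneg A) fun i _ => lam_le_top hb hi₀ i

/-- **The vacuum tops the flux-free sector**: `Λ_0 = λ_{i₀}` (the top eigenvector is flux-free and carries the weight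
`q_{i₀}(0) = λ_{i₀}² ≠ 0`). [cite: tHooft1979Flux, §4 (4.3)–(4.5) and §5 (5.3)] [cite: ReedSimonIV1978, Thm XIII.43 and Thm XIII.44] -/
theorem fluxTop_zero_eq (hK : StronglyMeasurable (uncurry K)) (hC : ∀ x y, ‖K x y‖ ≤ C)
    (hsymm : ∀ x y, K x y = K y x) (hKpos : ∀ x y, 0 < K x y)
    (hA : ∀ φ : Lp ℝ 2 μ, (A φ : X → ℝ) =ᵐ[μ] fun x => ∫ y, K x y * φ y ∂μ)
    (hb : ∀ i, A (b i) = lam i • b i) (hT : ∀ k, MeasurePreserving (T k) μ μ)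
    (hKT : ∀ k x y, K (T k x) (T k y) = K x y) {i₀ : ι} (hi₀ : lam i₀ = ‖A‖) (hlam₀ : lam i₀ ≠ 0) :
    (⨆ i : {i // ((Fintype.card Γ : ℂ)⁻¹ * ∑ k, conj ((0 : AddChar Γ ℂ) k) *
        ((∫ x, (∫ z, K (T k x) z * b i z ∂μ) * (∫ z, K x z * b i z ∂μ) ∂μ : ℝ) : ℂ)).re ≠ 0}, lam i) = lam i₀ := by
  refine le_antisymm (fluxTop_le_top hb hi₀ 0) ?_
  have htop := fluxCoeff_top hK hC hsymm hKpos hA hb hT hKT hi₀ hlam₀ (0 : AddChar Γ ℂ)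
  rw [if_pos rfl] at htop
  have hne : ((Fintype.card Γ : ℂ)⁻¹ * ∑ k, conj ((0 : AddChar Γ ℂ) k) *
      ((∫ x, (∫ z, K (T k x) z * b i₀ z ∂μ) * (∫ z, K x z * b i₀ z ∂μ) ∂μ : ℝ) : ℂ)).re ≠ 0 := by
    rw [htop, Complex.ofReal_re]
    exact pow_ne_zero 2 hlam₀
  exact le_spectralTop (lam_le_top hb hi₀) hne

/-- **Non-zero flux lives below the gap**: for `ψ ≠ 0`, if `λᵢ ≤ Λ` for all `i ≠ i₀` (`0 ≤ Λ`) then `Λ_ψ ≤ Λ` — the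
vacuum carries no flux (`fluxCoeff_top`), so every level with weight in the sector is sub-dominant.
[cite: tHooft1979Flux, §4 (4.3)–(4.5) and §5 (5.3)–(5.4)] [cite: ReedSimonIV1978, Thm XIII.43 and Thm XIII.44] -/
theorem fluxTop_le_of_ne_zero (hK : StronglyMeasurable (uncurry K)) (hC : ∀ x y, ‖K x y‖ ≤ C)
    (hsymm : ∀ x y, K x y = K y x) (hKpos : ∀ x y, 0 < K x y)
    (hA : ∀ φ : Lp ℝ 2 μ, (A φ : X → ℝ) =ᵐ[μ] fun x => ∫ y, K x y * φ y ∂μ)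
    (hb : ∀ i, A (b i) = lam i • b i) (hT : ∀ k, MeasurePreserving (T k) μ μ)
    (hKT : ∀ k x y, K (T k x) (T k y) = K x y) {i₀ : ι} (hi₀ : lam i₀ = ‖A‖) (hlam₀ : lam i₀ ≠ 0)
    {Λ : ℝ} (hΛ0 : 0 ≤ Λ) (hΛ : ∀ i, i ≠ i₀ → lam i ≤ Λ) {ψ : AddChar Γ ℂ} (hψ : ψ ≠ 0) :
    (⨆ i : {i // ((Fintype.card Γ : ℂ)⁻¹ * ∑ k, conj (ψ k) *
        ((∫ x, (∫ z, K (T k x) z * b i z ∂μ) * (∫ z, K x z * b i z ∂μ) ∂μ : ℝ) : ℂ)).re ≠ 0}, lam i) ≤ Λ := by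
  classical
  have htop := fluxCoeff_top hK hC hsymm hKpos hA hb hT hKT hi₀ hlam₀ ψ
  rw [if_neg hψ] at htop
  refine spectralTop_le hΛ0 fun i hi => hΛ i ?_
  rintro rfl
  exact hi (by rw [htop, Complex.zero_re])

/-! ### Non-degenerate sectors -/

/-- A sector with `z_ψ(3) > 0` is NON-DEGENERATE: some level with weight in it is non-zero
(`∃ i, qᵢ(ψ) ≠ 0 ∧ λᵢ > 0`). [cite: tHooft1979Flux, §5 (5.3)] -/
theorem exists_fluxCoeff_ne_zero_of_pos [Countable ι] (hK : StronglyMeasurable (uncurry K))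
    (hC : ∀ x y, ‖K x y‖ ≤ C) (hsymm : ∀ x y, K x y = K y x)
    (hA : ∀ φ : Lp ℝ 2 μ, (A φ : X → ℝ) =ᵐ[μ] fun x => ∫ y, K x y * φ y ∂μ)
    (hb : ∀ i, A (b i) = lam i • b i) (hlam : ∀ i, 0 ≤ lam i) (hT : ∀ k, MeasurePreserving (T k) μ μ)
    {z : Γ → ℕ → ℝ}
    (hz : ∀ k M, z k (M + 2) =
      ∫ x, ((fun f : X → ℝ => fun w => ∫ y, K w y * f y ∂μ)^[M + 1] (fun y => K y x)) (T k x) ∂μ)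
    {ψ : AddChar Γ ℂ} (hpos : 0 < ((Fintype.card Γ : ℂ)⁻¹ * ∑ k, conj (ψ k) * (z k 3 : ℂ)).re) :
    ∃ i, ((Fintype.card Γ : ℂ)⁻¹ * ∑ k, conj (ψ k) *
        ((∫ x, (∫ z, K (T k x) z * b i z ∂μ) * (∫ z, K x z * b i z ∂μ) ∂μ : ℝ) : ℂ)).re ≠ 0 ∧ 0 < lam i :=
  exists_of_spectralSum_one_pos
    (S := fun M => ((Fintype.card Γ : ℂ)⁻¹ * ∑ k, conj (ψ k) * (z k (M + 2) : ℂ)).re)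
    hlam (hasSum_re_fluxSector hK hC hsymm hA hb hT hz ψ) hpos

/-- In a non-degenerate sector every `z_ψ(M+2) > 0`. [cite: tHooft1979Flux, §5 (5.3)] -/
theorem re_fluxSector_pos [Countable ι] (hK : StronglyMeasurable (uncurry K))
    (hC : ∀ x y, ‖K x y‖ ≤ C) (hsymm : ∀ x y, K x y = K y x)
    (hA : ∀ φ : Lp ℝ 2 μ, (A φ : X → ℝ) =ᵐ[μ] fun x => ∫ y, K x y * φ y ∂μ)
    (hb : ∀ i, A (b i) = lam i • b i) (hlam : ∀ i, 0 ≤ lam i) (hT : ∀ k, MeasurePreserving (T k) μ μ)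
    (hT0 : T 0 = id) (hTadd : ∀ k k' x, T (k + k') x = T k (T k' x)) {z : Γ → ℕ → ℝ}
    (hz : ∀ k M, z k (M + 2) =
      ∫ x, ((fun f : X → ℝ => fun w => ∫ y, K w y * f y ∂μ)^[M + 1] (fun y => K y x)) (T k x) ∂μ)
    {ψ : AddChar Γ ℂ}
    (hne : ∃ i, ((Fintype.card Γ : ℂ)⁻¹ * ∑ k, conj (ψ k) *
        ((∫ x, (∫ z, K (T k x) z * b i z ∂μ) * (∫ z, K x z * b i z ∂μ) ∂μ : ℝ) : ℂ)).re ≠ 0 ∧ 0 < lam i)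
    (M : ℕ) : 0 < ((Fintype.card Γ : ℂ)⁻¹ * ∑ k, conj (ψ k) * (z k (M + 2) : ℂ)).re :=
  spectralSum_pos (S := fun M => ((Fintype.card Γ : ℂ)⁻¹ * ∑ k, conj (ψ k) * (z k (M + 2) : ℂ)).re)
    hlam (fun i => (fluxCoeff_nonneg (b := b) hK hC hT hT0 hTadd i ψ).1)
    (hasSum_re_fluxSector hK hC hsymm hA hb hT hz ψ) hne M

/-- The flux-free sector is non-degenerate (it contains the vacuum: `q_{i₀}(0) = λ_{i₀}² ≠ 0`, `λ_{i₀} > 0`).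
[cite: tHooft1979Flux, §4 (4.3)–(4.5) and §5 (5.3)] [cite: ReedSimonIV1978, Thm XIII.43 and Thm XIII.44] -/
theorem exists_fluxCoeff_zero_ne_zero (hK : StronglyMeasurable (uncurry K)) (hC : ∀ x y, ‖K x y‖ ≤ C)
    (hsymm : ∀ x y, K x y = K y x) (hKpos : ∀ x y, 0 < K x y)
    (hA : ∀ φ : Lp ℝ 2 μ, (A φ : X → ℝ) =ᵐ[μ] fun x => ∫ y, K x y * φ y ∂μ)
    (hb : ∀ i, A (b i) = lam i • b i) (hT : ∀ k, MeasurePreserving (T k) μ μ)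
    (hKT : ∀ k x y, K (T k x) (T k y) = K x y) {i₀ : ι} (hi₀ : lam i₀ = ‖A‖) (hlam₀ : lam i₀ ≠ 0) :
    ∃ i, ((Fintype.card Γ : ℂ)⁻¹ * ∑ k, conj ((0 : AddChar Γ ℂ) k) *
        ((∫ x, (∫ z, K (T k x) z * b i z ∂μ) * (∫ z, K x z * b i z ∂μ) ∂μ : ℝ) : ℂ)).re ≠ 0 ∧ 0 < lam i := by
  have htop := fluxCoeff_top hK hC hsymm hKpos hA hb hT hKT hi₀ hlam₀ (0 : AddChar Γ ℂ)
  rw [if_pos rfl] at htop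
  refine ⟨i₀, ?_, lt_of_le_of_ne (hi₀ ▸ norm_nonneg A) (Ne.symm hlam₀)⟩
  rw [htop, Complex.ofReal_re]
  exact pow_ne_zero 2 hlam₀

/-! ### 't Hooft's zero-temperature limit -/

/-- ★ **'t Hooft's limit — the flux free energy per unit time converges to the energy of the lowest state of the
sector**: in a non-degenerate sector, `log z_ψ(M+2) / M → log Λ_ψ` as `M → ∞`.
[cite: tHooft1979Flux, §5 after (5.4)] [cite: Greensite2011, §4.4 (4.41)–(4.44)] -/
theorem tendsto_log_re_fluxSector_div [Countable ι] (hK : StronglyMeasurable (uncurry K))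
    (hC : ∀ x y, ‖K x y‖ ≤ C) (hsymm : ∀ x y, K x y = K y x)
    (hA : ∀ φ : Lp ℝ 2 μ, (A φ : X → ℝ) =ᵐ[μ] fun x => ∫ y, K x y * φ y ∂μ)
    (hb : ∀ i, A (b i) = lam i • b i) (hlam : ∀ i, 0 ≤ lam i) (hT : ∀ k, MeasurePreserving (T k) μ μ)
    (hT0 : T 0 = id) (hTadd : ∀ k k' x, T (k + k') x = T k (T k' x)) {z : Γ → ℕ → ℝ}
    (hz : ∀ k M, z k (M + 2) =
      ∫ x, ((fun f : X → ℝ => fun w => ∫ y, K w y * f y ∂μ)^[M + 1] (fun y => K y x)) (T k x) ∂μ)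
    {ψ : AddChar Γ ℂ}
    (hne : ∃ i, ((Fintype.card Γ : ℂ)⁻¹ * ∑ k, conj (ψ k) *
        ((∫ x, (∫ z, K (T k x) z * b i z ∂μ) * (∫ z, K x z * b i z ∂μ) ∂μ : ℝ) : ℂ)).re ≠ 0 ∧ 0 < lam i) :
    Tendsto (fun M : ℕ => Real.log ((Fintype.card Γ : ℂ)⁻¹ * ∑ k, conj (ψ k) * (z k (M + 2) : ℂ)).re / M) atTop
      (𝓝 (Real.log (⨆ i : {i // ((Fintype.card Γ : ℂ)⁻¹ * ∑ k, conj (ψ k) *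
        ((∫ x, (∫ z, K (T k x) z * b i z ∂μ) * (∫ z, K x z * b i z ∂μ) ∂μ : ℝ) : ℂ)).re ≠ 0}, lam i))) :=
  tendsto_log_spectralSum_div (S := fun M => ((Fintype.card Γ : ℂ)⁻¹ * ∑ k, conj (ψ k) * (z k (M + 2) : ℂ)).re)
    hlam (lam_le_norm hb) (fun i => (fluxCoeff_nonneg (b := b) hK hC hT hT0 hTadd i ψ).1)
    (hasSum_re_fluxSector hK hC hsymm hA hb hT hz ψ) hne

/-- Root-test form of 't Hooft's limit: `z_ψ(M+2)^{1/M} → Λ_ψ` in a non-degenerate sector.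
[cite: tHooft1979Flux, §5 after (5.4)] -/
theorem tendsto_re_fluxSector_rpow_inv [Countable ι] (hK : StronglyMeasurable (uncurry K))
    (hC : ∀ x y, ‖K x y‖ ≤ C) (hsymm : ∀ x y, K x y = K y x)
    (hA : ∀ φ : Lp ℝ 2 μ, (A φ : X → ℝ) =ᵐ[μ] fun x => ∫ y, K x y * φ y ∂μ)
    (hb : ∀ i, A (b i) = lam i • b i) (hlam : ∀ i, 0 ≤ lam i) (hT : ∀ k, MeasurePreserving (T k) μ μ)
    (hT0 : T 0 = id) (hTadd : ∀ k k' x, T (k + k') x = T k (T k' x)) {z : Γ → ℕ → ℝ}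
    (hz : ∀ k M, z k (M + 2) =
      ∫ x, ((fun f : X → ℝ => fun w => ∫ y, K w y * f y ∂μ)^[M + 1] (fun y => K y x)) (T k x) ∂μ)
    {ψ : AddChar Γ ℂ}
    (hne : ∃ i, ((Fintype.card Γ : ℂ)⁻¹ * ∑ k, conj (ψ k) *
        ((∫ x, (∫ z, K (T k x) z * b i z ∂μ) * (∫ z, K x z * b i z ∂μ) ∂μ : ℝ) : ℂ)).re ≠ 0 ∧ 0 < lam i) :
    Tendsto (fun M : ℕ => ((Fintype.card Γ : ℂ)⁻¹ * ∑ k, conj (ψ k) * (z k (M + 2) : ℂ)).re ^ (1 / (M : ℝ)))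
      atTop (𝓝 (⨆ i : {i // ((Fintype.card Γ : ℂ)⁻¹ * ∑ k, conj (ψ k) *
        ((∫ x, (∫ z, K (T k x) z * b i z ∂μ) * (∫ z, K x z * b i z ∂μ) ∂μ : ℝ) : ℂ)).re ≠ 0}, lam i)) :=
  tendsto_spectralSum_rpow_inv (S := fun M => ((Fintype.card Γ : ℂ)⁻¹ * ∑ k, conj (ψ k) * (z k (M + 2) : ℂ)).re)
    hlam (lam_le_norm hb) (fun i => (fluxCoeff_nonneg (b := b) hK hC hT hT0 hTadd i ψ).1)
    (hasSum_re_fluxSector hK hC hsymm hA hb hT hz ψ) hne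

/-- ★ **The flux energy above the vacuum**: in a non-degenerate sector `ψ` of a positive `Γ`-invariant kernel,
`log (z_0(M+2) / z_ψ(M+2)) / M → E_ψ := log λ_{i₀} − log Λ_ψ` — 't Hooft's `E(e)` normalised so that the flux-free
energy vanishes ("Usually, `C` will be adapted so that `F(0; a, β) = 0`", §8).
[cite: tHooft1979Flux, §5 after (5.4) and §8 after (8.7)] [cite: Greensite2011, §4.4 (4.41)–(4.44)] -/
theorem tendsto_log_fluxSector_ratio_div [Countable ι] (hK : StronglyMeasurable (uncurry K))
    (hC : ∀ x y, ‖K x y‖ ≤ C) (hsymm : ∀ x y, K x y = K y x) (hKpos : ∀ x y, 0 < K x y)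
    (hA : ∀ φ : Lp ℝ 2 μ, (A φ : X → ℝ) =ᵐ[μ] fun x => ∫ y, K x y * φ y ∂μ)
    (hb : ∀ i, A (b i) = lam i • b i) (hlam : ∀ i, 0 ≤ lam i) {i₀ : ι} (hi₀ : lam i₀ = ‖A‖)
    (hlam₀ : lam i₀ ≠ 0) (hT : ∀ k, MeasurePreserving (T k) μ μ) (hT0 : T 0 = id)
    (hTadd : ∀ k k' x, T (k + k') x = T k (T k' x)) (hKT : ∀ k x y, K (T k x) (T k y) = K x y)
    {z : Γ → ℕ → ℝ}
    (hz : ∀ k M, z k (M + 2) =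
      ∫ x, ((fun f : X → ℝ => fun w => ∫ y, K w y * f y ∂μ)^[M + 1] (fun y => K y x)) (T k x) ∂μ)
    {ψ : AddChar Γ ℂ}
    (hne : ∃ i, ((Fintype.card Γ : ℂ)⁻¹ * ∑ k, conj (ψ k) *
        ((∫ x, (∫ z, K (T k x) z * b i z ∂μ) * (∫ z, K x z * b i z ∂μ) ∂μ : ℝ) : ℂ)).re ≠ 0 ∧ 0 < lam i) :
    Tendsto (fun M : ℕ => Real.log (((Fintype.card Γ : ℂ)⁻¹ * ∑ k, conj ((0 : AddChar Γ ℂ) k) * (z k (M + 2) : ℂ)).re /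
        ((Fintype.card Γ : ℂ)⁻¹ * ∑ k, conj (ψ k) * (z k (M + 2) : ℂ)).re) / M) atTop
      (𝓝 (Real.log (lam i₀) - Real.log (⨆ i : {i // ((Fintype.card Γ : ℂ)⁻¹ * ∑ k, conj (ψ k) *
        ((∫ x, (∫ z, K (T k x) z * b i z ∂μ) * (∫ z, K x z * b i z ∂μ) ∂μ : ℝ) : ℂ)).re ≠ 0}, lam i))) := by
  have hne0 := exists_fluxCoeff_zero_ne_zero (Γ := Γ) hK hC hsymm hKpos hA hb hT hKT hi₀ hlam₀
  have h0 := tendsto_log_re_fluxSector_div hK hC hsymm hA hb hlam hT hT0 hTadd hz hne0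
  rw [fluxTop_zero_eq hK hC hsymm hKpos hA hb hT hKT hi₀ hlam₀] at h0
  have hψ := tendsto_log_re_fluxSector_div hK hC hsymm hA hb hlam hT hT0 hTadd hz hne
  refine (h0.sub hψ).congr fun M => ?_
  have hp0 := re_fluxSector_pos hK hC hsymm hA hb hlam hT hT0 hTadd hz hne0 M
  have hpψ := re_fluxSector_pos hK hC hsymm hA hb hlam hT hT0 hTadd hz hne M
  rw [← sub_div, Real.log_div hp0.ne' hpψ.ne']

omit [IsFiniteMeasure μ] in
/-- **Flux energies are non-negative**: `0 ≤ log λ_{i₀} − log Λ_ψ` in every non-degenerate sector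
(`Λ_ψ ≤ λ_{i₀}`). [cite: tHooft1979Flux, §5 (5.1)–(5.4)] [cite: ReedSimonIV1978, Thm XIII.43 and Thm XIII.44] -/
theorem fluxEnergy_nonneg (hb : ∀ i, A (b i) = lam i • b i) {i₀ : ι} (hi₀ : lam i₀ = ‖A‖) {ψ : AddChar Γ ℂ}
    (hne : ∃ i, ((Fintype.card Γ : ℂ)⁻¹ * ∑ k, conj (ψ k) *
        ((∫ x, (∫ z, K (T k x) z * b i z ∂μ) * (∫ z, K x z * b i z ∂μ) ∂μ : ℝ) : ℂ)).re ≠ 0 ∧ 0 < lam i) :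
    0 ≤ Real.log (lam i₀) - Real.log (⨆ i : {i // ((Fintype.card Γ : ℂ)⁻¹ * ∑ k, conj (ψ k) *
        ((∫ x, (∫ z, K (T k x) z * b i z ∂μ) * (∫ z, K x z * b i z ∂μ) ∂μ : ℝ) : ℂ)).re ≠ 0}, lam i) :=
  sub_nonneg.2 (Real.log_le_log (spectralTop_pos (lam_le_top hb hi₀) hne) (fluxTop_le_top hb hi₀ ψ))

/-- **A non-zero flux costs at least the gap**: if `λᵢ ≤ Λ` for `i ≠ i₀` with `0 < Λ`, then for `ψ ≠ 0`
non-degenerate, `log λ_{i₀} − log Λ ≤ E_ψ = log λ_{i₀} − log Λ_ψ` — the energy form of `re_fluxSector_le_pow_mul`.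
[cite: tHooft1979Flux, §5 after (5.4)] [cite: ReedSimonIV1978, Thm XIII.43 and Thm XIII.44] -/
theorem log_top_sub_log_le_fluxEnergy (hK : StronglyMeasurable (uncurry K)) (hC : ∀ x y, ‖K x y‖ ≤ C)
    (hsymm : ∀ x y, K x y = K y x) (hKpos : ∀ x y, 0 < K x y)
    (hA : ∀ φ : Lp ℝ 2 μ, (A φ : X → ℝ) =ᵐ[μ] fun x => ∫ y, K x y * φ y ∂μ)
    (hb : ∀ i, A (b i) = lam i • b i) (hT : ∀ k, MeasurePreserving (T k) μ μ)
    (hKT : ∀ k x y, K (T k x) (T k y) = K x y) {i₀ : ι} (hi₀ : lam i₀ = ‖A‖) (hlam₀ : lam i₀ ≠ 0)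
    {Λ : ℝ} (hΛ0 : 0 < Λ) (hΛ : ∀ i, i ≠ i₀ → lam i ≤ Λ) {ψ : AddChar Γ ℂ} (hψ : ψ ≠ 0)
    (hne : ∃ i, ((Fintype.card Γ : ℂ)⁻¹ * ∑ k, conj (ψ k) *
        ((∫ x, (∫ z, K (T k x) z * b i z ∂μ) * (∫ z, K x z * b i z ∂μ) ∂μ : ℝ) : ℂ)).re ≠ 0 ∧ 0 < lam i) :
    Real.log (lam i₀) - Real.log Λ ≤ Real.log (lam i₀) - Real.log (⨆ i : {i // ((Fintype.card Γ : ℂ)⁻¹ * ∑ k, conj (ψ k) *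
        ((∫ x, (∫ z, K (T k x) z * b i z ∂μ) * (∫ z, K x z * b i z ∂μ) ∂μ : ℝ) : ℂ)).re ≠ 0}, lam i) :=
  sub_le_sub_left (Real.log_le_log (spectralTop_pos (lam_le_top hb hi₀) hne)
    (fluxTop_le_of_ne_zero hK hC hsymm hKpos hA hb hT hKT hi₀ hlam₀ hΛ0.le hΛ hψ)) _

/-! ### Effective flux energies -/

/-- Every EFFECTIVE flux energy bounds the lowest energy of the sector from above:
`−log Λ_ψ ≤ log (z_ψ(M+2)/z_ψ(M+3))` ("the effective mass is an upper bound"), in a non-degenerate sector.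
[cite: Michael1997, §2 eqs. (2)–(3)] [cite: tHooft1979Flux, §5 after (5.4)] -/
theorem neg_log_fluxTop_le_fluxEffectiveEnergy [Countable ι] (hK : StronglyMeasurable (uncurry K))
    (hC : ∀ x y, ‖K x y‖ ≤ C) (hsymm : ∀ x y, K x y = K y x)
    (hA : ∀ φ : Lp ℝ 2 μ, (A φ : X → ℝ) =ᵐ[μ] fun x => ∫ y, K x y * φ y ∂μ)
    (hb : ∀ i, A (b i) = lam i • b i) (hlam : ∀ i, 0 ≤ lam i) (hT : ∀ k, MeasurePreserving (T k) μ μ)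
    (hT0 : T 0 = id) (hTadd : ∀ k k' x, T (k + k') x = T k (T k' x)) {z : Γ → ℕ → ℝ}
    (hz : ∀ k M, z k (M + 2) =
      ∫ x, ((fun f : X → ℝ => fun w => ∫ y, K w y * f y ∂μ)^[M + 1] (fun y => K y x)) (T k x) ∂μ)
    {ψ : AddChar Γ ℂ}
    (hne : ∃ i, ((Fintype.card Γ : ℂ)⁻¹ * ∑ k, conj (ψ k) *
        ((∫ x, (∫ z, K (T k x) z * b i z ∂μ) * (∫ z, K x z * b i z ∂μ) ∂μ : ℝ) : ℂ)).re ≠ 0 ∧ 0 < lam i) (M : ℕ) :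
    -Real.log (⨆ i : {i // ((Fintype.card Γ : ℂ)⁻¹ * ∑ k, conj (ψ k) *
        ((∫ x, (∫ z, K (T k x) z * b i z ∂μ) * (∫ z, K x z * b i z ∂μ) ∂μ : ℝ) : ℂ)).re ≠ 0}, lam i) ≤
      Real.log (((Fintype.card Γ : ℂ)⁻¹ * ∑ k, conj (ψ k) * (z k (M + 2) : ℂ)).re /
        ((Fintype.card Γ : ℂ)⁻¹ * ∑ k, conj (ψ k) * (z k (M + 1 + 2) : ℂ)).re) :=
  (neg_log_spectralTop_le_effectiveEnergy
    (S := fun M => ((Fintype.card Γ : ℂ)⁻¹ * ∑ k, conj (ψ k) * (z k (M + 2) : ℂ)).re)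
    hlam (lam_le_norm hb) (fun i => (fluxCoeff_nonneg (b := b) hK hC hT hT0 hTadd i ψ).1)
    (hasSum_re_fluxSector hK hC hsymm hA hb hT hz ψ) hne M).2

/-- The effective flux energies are non-increasing in `M`. [cite: Michael1997, §2 eqs. (2)–(3)] -/
theorem fluxEffectiveEnergy_succ_le [Countable ι] (hK : StronglyMeasurable (uncurry K))
    (hC : ∀ x y, ‖K x y‖ ≤ C) (hsymm : ∀ x y, K x y = K y x)
    (hA : ∀ φ : Lp ℝ 2 μ, (A φ : X → ℝ) =ᵐ[μ] fun x => ∫ y, K x y * φ y ∂μ)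
    (hb : ∀ i, A (b i) = lam i • b i) (hlam : ∀ i, 0 ≤ lam i) (hT : ∀ k, MeasurePreserving (T k) μ μ)
    (hT0 : T 0 = id) (hTadd : ∀ k k' x, T (k + k') x = T k (T k' x)) {z : Γ → ℕ → ℝ}
    (hz : ∀ k M, z k (M + 2) =
      ∫ x, ((fun f : X → ℝ => fun w => ∫ y, K w y * f y ∂μ)^[M + 1] (fun y => K y x)) (T k x) ∂μ)
    {ψ : AddChar Γ ℂ}
    (hne : ∃ i, ((Fintype.card Γ : ℂ)⁻¹ * ∑ k, conj (ψ k) *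
        ((∫ x, (∫ z, K (T k x) z * b i z ∂μ) * (∫ z, K x z * b i z ∂μ) ∂μ : ℝ) : ℂ)).re ≠ 0 ∧ 0 < lam i) (M : ℕ) :
    Real.log (((Fintype.card Γ : ℂ)⁻¹ * ∑ k, conj (ψ k) * (z k (M + 1 + 2) : ℂ)).re /
        ((Fintype.card Γ : ℂ)⁻¹ * ∑ k, conj (ψ k) * (z k (M + 2 + 2) : ℂ)).re) ≤
      Real.log (((Fintype.card Γ : ℂ)⁻¹ * ∑ k, conj (ψ k) * (z k (M + 2) : ℂ)).re /
        ((Fintype.card Γ : ℂ)⁻¹ * ∑ k, conj (ψ k) * (z k (M + 1 + 2) : ℂ)).re) :=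
  effectiveEnergy_succ_le (S := fun M => ((Fintype.card Γ : ℂ)⁻¹ * ∑ k, conj (ψ k) * (z k (M + 2) : ℂ)).re)
    hlam (fun i => (fluxCoeff_nonneg (b := b) hK hC hT hT0 hTadd i ψ).1)
    (hasSum_re_fluxSector hK hC hsymm hA hb hT hz ψ) hne M

/-- ★ **The effective flux energies converge to the energy of the lowest state of the sector**:
`log (z_ψ(M+2)/z_ψ(M+3)) → −log Λ_ψ` (Michael's `m̂₀ = lim m̂_eff(t)` in the flux channel `ψ`).
[cite: Michael1997, §2 eqs. (2)–(3)] [cite: tHooft1979Flux, §5 after (5.4)] -/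
theorem tendsto_fluxEffectiveEnergy [Countable ι] (hK : StronglyMeasurable (uncurry K))
    (hC : ∀ x y, ‖K x y‖ ≤ C) (hsymm : ∀ x y, K x y = K y x)
    (hA : ∀ φ : Lp ℝ 2 μ, (A φ : X → ℝ) =ᵐ[μ] fun x => ∫ y, K x y * φ y ∂μ)
    (hb : ∀ i, A (b i) = lam i • b i) (hlam : ∀ i, 0 ≤ lam i) (hT : ∀ k, MeasurePreserving (T k) μ μ)
    (hT0 : T 0 = id) (hTadd : ∀ k k' x, T (k + k') x = T k (T k' x)) {z : Γ → ℕ → ℝ}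
    (hz : ∀ k M, z k (M + 2) =
      ∫ x, ((fun f : X → ℝ => fun w => ∫ y, K w y * f y ∂μ)^[M + 1] (fun y => K y x)) (T k x) ∂μ)
    {ψ : AddChar Γ ℂ}
    (hne : ∃ i, ((Fintype.card Γ : ℂ)⁻¹ * ∑ k, conj (ψ k) *
        ((∫ x, (∫ z, K (T k x) z * b i z ∂μ) * (∫ z, K x z * b i z ∂μ) ∂μ : ℝ) : ℂ)).re ≠ 0 ∧ 0 < lam i) :
    Tendsto (fun M : ℕ => Real.log (((Fintype.card Γ : ℂ)⁻¹ * ∑ k, conj (ψ k) * (z k (M + 2) : ℂ)).re /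
        ((Fintype.card Γ : ℂ)⁻¹ * ∑ k, conj (ψ k) * (z k (M + 1 + 2) : ℂ)).re)) atTop
      (𝓝 (-Real.log (⨆ i : {i // ((Fintype.card Γ : ℂ)⁻¹ * ∑ k, conj (ψ k) *
        ((∫ x, (∫ z, K (T k x) z * b i z ∂μ) * (∫ z, K x z * b i z ∂μ) ∂μ : ℝ) : ℂ)).re ≠ 0}, lam i))) :=
  tendsto_effectiveEnergy (S := fun M => ((Fintype.card Γ : ℂ)⁻¹ * ∑ k, conj (ψ k) * (z k (M + 2) : ℂ)).re)
    hlam (lam_le_norm hb) (fun i => (fluxCoeff_nonneg (b := b) hK hC hT hT0 hTadd i ψ).1)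
    (hasSum_re_fluxSector hK hC hsymm hA hb hT hz ψ) hne


/-! ### The finite-volume gap is attained in a flux sector

The first excited level of the box, `λ₁ := ⨆ {λᵢ : i ≠ i₀}`, lies in SOME flux sector: states are classified by their
electric flux ('t Hooft §4 (4.3)–(4.5)), every eigenvector with `λᵢ ≠ 0` carries weight in at least one sector
(`Σ_ψ qᵢ(ψ) = λᵢ²`), so `λ₁ = max_ψ ⨆ {λᵢ : i ≠ i₀, qᵢ(ψ) ≠ 0}`; for `ψ ≠ 0` the constraint `i ≠ i₀` is void (the
vacuum is flux-free) and the inner supremum is the sector top `Λ_ψ`.  In energy language: the finite-volume gap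
`log λ_{i₀} − log λ₁` is the minimum of the flux energies `E_ψ` (`ψ ≠ 0`) and of the gap inside the flux-free sector. -/

/-- (plumbing) Dropping the zero levels does not change a supremum of non-negative levels. [folklore] -/
private theorem iSup_eq_iSup_sq_ne_zero {lam' : ι → ℝ} {L : ℝ} {P : ι → Prop} (hlam : ∀ i, 0 ≤ lam' i)
    (hL : ∀ i, lam' i ≤ L) :
    (⨆ i : {i // P i}, lam' i) = ⨆ i : {i // P i ∧ lam' i ^ 2 ≠ 0}, lam' i := by
  have hbdd : BddAbove (Set.range fun i : {i // P i} => lam' i) := ⟨L, by rintro _ ⟨i, rfl⟩; exact hL i⟩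
  have hbdd' : BddAbove (Set.range fun i : {i // P i ∧ lam' i ^ 2 ≠ 0} => lam' i) :=
    ⟨L, by rintro _ ⟨i, rfl⟩; exact hL i⟩
  refine le_antisymm ?_ ?_
  · refine Real.iSup_le (fun i => ?_) (Real.iSup_nonneg fun i => hlam i)
    by_cases h : lam' i = 0
    · rw [h]; exact Real.iSup_nonneg fun i => hlam i
    · exact le_ciSup hbdd' ⟨i, i.2, pow_ne_zero 2 h⟩
  · exact Real.iSup_le (fun i => le_ciSup hbdd ⟨i, i.2.1⟩) (Real.iSup_nonneg fun i => hlam i)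

/-- (plumbing) For finitely many non-negative weight functions `q ψ` with `Σ_ψ q ψ i = w i`, the top of the support of `w`
is the maximum over `ψ` of the tops of the supports of the `q ψ` (under a side constraint `P`). [folklore] -/
private theorem iSup_support_sum_eq {Ψ : Type*} [Fintype Ψ] {lam' : ι → ℝ} {q : Ψ → ι → ℝ} {w : ι → ℝ} {L : ℝ}
    {P : ι → Prop} (hlam : ∀ i, 0 ≤ lam' i) (hL : ∀ i, lam' i ≤ L) (hq : ∀ ψ i, 0 ≤ q ψ i)
    (hw : ∀ i, ∑ ψ, q ψ i = w i) :
    (⨆ i : {i // P i ∧ w i ≠ 0}, lam' i) = ⨆ ψ, ⨆ i : {i // P i ∧ q ψ i ≠ 0}, lam' i := by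
  have hbdd : ∀ ψ, BddAbove (Set.range fun i : {i // P i ∧ q ψ i ≠ 0} => lam' i) :=
    fun ψ => ⟨L, by rintro _ ⟨i, rfl⟩; exact hL i⟩
  have hbddw : BddAbove (Set.range fun i : {i // P i ∧ w i ≠ 0} => lam' i) :=
    ⟨L, by rintro _ ⟨i, rfl⟩; exact hL i⟩
  have hin : ∀ ψ, 0 ≤ ⨆ i : {i // P i ∧ q ψ i ≠ 0}, lam' i := fun ψ => Real.iSup_nonneg fun i => hlam i
  have hout : BddAbove (Set.range fun ψ => ⨆ i : {i // P i ∧ q ψ i ≠ 0}, lam' i) := (Set.finite_range _).bddAbove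
  refine le_antisymm ?_ ?_
  · refine Real.iSup_le (fun i => ?_) (Real.iSup_nonneg hin)
    obtain ⟨i, hPi, hwi⟩ := i
    have hex : ∃ ψ, q ψ i ≠ 0 := by
      by_contra h
      push Not at h
      exact hwi (by rw [← hw i]; exact Finset.sum_eq_zero fun ψ _ => h ψ)
    obtain ⟨ψ, hψ⟩ := hex
    calc lam' i ≤ ⨆ j : {j // P j ∧ q ψ j ≠ 0}, lam' j := le_ciSup (hbdd ψ) ⟨i, hPi, hψ⟩
      _ ≤ ⨆ ψ, ⨆ j : {j // P j ∧ q ψ j ≠ 0}, lam' j := le_ciSup hout ψ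
  · refine Real.iSup_le (fun ψ => ?_) (Real.iSup_nonneg fun i => hlam i)
    refine Real.iSup_le (fun i => ?_) (Real.iSup_nonneg fun i => hlam i)
    obtain ⟨i, hPi, hqi⟩ := i
    have hwi : w i ≠ 0 := by
      have hpos : 0 < q ψ i := lt_of_le_of_ne (hq ψ i) (Ne.symm hqi)
      have hle : q ψ i ≤ w i := by
        rw [← hw i]
        exact Finset.single_le_sum (fun ψ' _ => hq ψ' i) (Finset.mem_univ ψ)
      exact ne_of_gt (lt_of_lt_of_le hpos hle)
    exact le_ciSup hbddw ⟨i, hPi, hwi⟩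

/-- ★ **The finite-volume gap is attained in a flux sector**: the first excited level of the box is the maximum over
the flux sectors of the top sub-dominant level carrying weight in the sector,
`⨆ {λᵢ : i ≠ i₀} = ⨆_ψ ⨆ {λᵢ : i ≠ i₀, qᵢ(ψ) ≠ 0}` — every eigenvector with `λᵢ ≠ 0` has `Σ_ψ qᵢ(ψ) = λᵢ² > 0`, hence
weight in some sector. [cite: tHooft1979Flux, §4 (4.3)–(4.5) and §5 (5.1)–(5.3)] [cite: ReedSimonIV1978, Thm XIII.43 and Thm XIII.44] -/
theorem iSup_ne_top_eq_iSup_sector (hK : StronglyMeasurable (uncurry K)) (hC : ∀ x y, ‖K x y‖ ≤ C)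
    (hA : ∀ φ : Lp ℝ 2 μ, (A φ : X → ℝ) =ᵐ[μ] fun x => ∫ y, K x y * φ y ∂μ)
    (hb : ∀ i, A (b i) = lam i • b i) (hlam : ∀ i, 0 ≤ lam i) (hT : ∀ k, MeasurePreserving (T k) μ μ)
    (hT0 : T 0 = id) (hTadd : ∀ k k' x, T (k + k') x = T k (T k' x)) (i₀ : ι) :
    (⨆ i : {i // i ≠ i₀}, lam i) = ⨆ ψ : AddChar Γ ℂ, ⨆ i : {i // i ≠ i₀ ∧ ((Fintype.card Γ : ℂ)⁻¹ * ∑ k, conj (ψ k) *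
        ((∫ x, (∫ z, K (T k x) z * b i z ∂μ) * (∫ z, K x z * b i z ∂μ) ∂μ : ℝ) : ℂ)).re ≠ 0}, lam i := by
  rw [iSup_eq_iSup_sq_ne_zero (P := fun i => i ≠ i₀) hlam (lam_le_norm hb)]
  refine iSup_support_sum_eq (P := fun i => i ≠ i₀) hlam (lam_le_norm hb)
    (fun ψ i => (fluxCoeff_nonneg (b := b) hK hC hT hT0 hTadd i ψ).1) fun i => ?_
  have h := congrArg Complex.re (sum_fluxCoeff (Γ := Γ) (T := T) hK hC hA hb hT0 i)
  rwa [Complex.re_sum, Complex.ofReal_re] at h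

/-- For a NON-ZERO flux the constraint `i ≠ i₀` is void (the vacuum carries no flux): the sub-dominant top of the
sector is the sector top `Λ_ψ`. [cite: tHooft1979Flux, §4 (4.3)–(4.5) and §5 (5.3)] [cite: ReedSimonIV1978, Thm XIII.43 and Thm XIII.44] -/
theorem iSup_ne_top_sector_eq_fluxTop (hK : StronglyMeasurable (uncurry K)) (hC : ∀ x y, ‖K x y‖ ≤ C)
    (hsymm : ∀ x y, K x y = K y x) (hKpos : ∀ x y, 0 < K x y)
    (hA : ∀ φ : Lp ℝ 2 μ, (A φ : X → ℝ) =ᵐ[μ] fun x => ∫ y, K x y * φ y ∂μ)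
    (hb : ∀ i, A (b i) = lam i • b i) (hT : ∀ k, MeasurePreserving (T k) μ μ)
    (hKT : ∀ k x y, K (T k x) (T k y) = K x y) {i₀ : ι} (hi₀ : lam i₀ = ‖A‖) (hlam₀ : lam i₀ ≠ 0)
    {ψ : AddChar Γ ℂ} (hψ : ψ ≠ 0) :
    (⨆ i : {i // i ≠ i₀ ∧ ((Fintype.card Γ : ℂ)⁻¹ * ∑ k, conj (ψ k) *
        ((∫ x, (∫ z, K (T k x) z * b i z ∂μ) * (∫ z, K x z * b i z ∂μ) ∂μ : ℝ) : ℂ)).re ≠ 0}, lam i) =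
      ⨆ i : {i // ((Fintype.card Γ : ℂ)⁻¹ * ∑ k, conj (ψ k) *
        ((∫ x, (∫ z, K (T k x) z * b i z ∂μ) * (∫ z, K x z * b i z ∂μ) ∂μ : ℝ) : ℂ)).re ≠ 0}, lam i := by
  classical
  have htop := fluxCoeff_top hK hC hsymm hKpos hA hb hT hKT hi₀ hlam₀ ψ
  rw [if_neg hψ] at htop
  have hvoid : ∀ i, ((Fintype.card Γ : ℂ)⁻¹ * ∑ k, conj (ψ k) *
      ((∫ x, (∫ z, K (T k x) z * b i z ∂μ) * (∫ z, K x z * b i z ∂μ) ∂μ : ℝ) : ℂ)).re ≠ 0 → i ≠ i₀ := by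
    rintro i hi rfl
    exact hi (by rw [htop, Complex.zero_re])
  exact Equiv.iSup_congr (Equiv.subtypeEquivRight fun i => ⟨fun h => h.2, fun h => ⟨hvoid i h, h⟩⟩) fun _ => rfl

/-- ★ **Some flux sector realises the gap**: there is a character `ψ` with
`⨆ {λᵢ : i ≠ i₀} = ⨆ {λᵢ : i ≠ i₀, qᵢ(ψ) ≠ 0}` — the first excited state of the box has a definite home among the
flux sectors (for `ψ ≠ 0` the right side is the sector top `Λ_ψ`, `iSup_ne_top_sector_eq_fluxTop`; for `ψ = 0` it is
the top of the flux-free sector below the vacuum).  Equivalently the finite-volume gap is the minimum of the flux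
energies `E_ψ`, `ψ ≠ 0`, and the internal gap of the flux-free sector.
[cite: tHooft1979Flux, §4 (4.3)–(4.5) and §5 (5.1)–(5.3)] [cite: ReedSimonIV1978, Thm XIII.43 and Thm XIII.44] -/
theorem exists_sector_iSup_ne_top_eq (hK : StronglyMeasurable (uncurry K)) (hC : ∀ x y, ‖K x y‖ ≤ C)
    (hA : ∀ φ : Lp ℝ 2 μ, (A φ : X → ℝ) =ᵐ[μ] fun x => ∫ y, K x y * φ y ∂μ)
    (hb : ∀ i, A (b i) = lam i • b i) (hlam : ∀ i, 0 ≤ lam i) (hT : ∀ k, MeasurePreserving (T k) μ μ)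
    (hT0 : T 0 = id) (hTadd : ∀ k k' x, T (k + k') x = T k (T k' x)) (i₀ : ι) :
    ∃ ψ : AddChar Γ ℂ, (⨆ i : {i // i ≠ i₀}, lam i) = ⨆ i : {i // i ≠ i₀ ∧ ((Fintype.card Γ : ℂ)⁻¹ * ∑ k, conj (ψ k) *
        ((∫ x, (∫ z, K (T k x) z * b i z ∂μ) * (∫ z, K x z * b i z ∂μ) ∂μ : ℝ) : ℂ)).re ≠ 0}, lam i := by
  rw [iSup_ne_top_eq_iSup_sector hK hC hA hb hlam hT hT0 hTadd i₀]
  obtain ⟨ψ, hψ⟩ := exists_eq_ciSup_of_finite (f := fun ψ : AddChar Γ ℂ => ⨆ i : {i // i ≠ i₀ ∧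
    ((Fintype.card Γ : ℂ)⁻¹ * ∑ k, conj (ψ k) *
      ((∫ x, (∫ z, K (T k x) z * b i z ∂μ) * (∫ z, K x z * b i z ∂μ) ∂μ : ℝ) : ℂ)).re ≠ 0}, lam i)
  exact ⟨ψ, hψ.symm⟩

omit [IsFiniteMeasure μ] in
/-- Each sector's sub-dominant top is below the first excited level: `⨆ {λᵢ : i ≠ i₀, qᵢ(ψ) ≠ 0} ≤ ⨆ {λᵢ : i ≠ i₀}` —
every flux energy, and the internal gap of the flux-free sector, is at least the finite-volume gap.
[cite: tHooft1979Flux, §5 after (5.4)] [cite: ReedSimonIV1978, Thm XIII.43 and Thm XIII.44] -/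
theorem iSup_ne_top_sector_le (hb : ∀ i, A (b i) = lam i • b i) (hlam : ∀ i, 0 ≤ lam i) (i₀ : ι) (ψ : AddChar Γ ℂ) :
    (⨆ i : {i // i ≠ i₀ ∧ ((Fintype.card Γ : ℂ)⁻¹ * ∑ k, conj (ψ k) *
        ((∫ x, (∫ z, K (T k x) z * b i z ∂μ) * (∫ z, K x z * b i z ∂μ) ∂μ : ℝ) : ℂ)).re ≠ 0}, lam i) ≤
      ⨆ i : {i // i ≠ i₀}, lam i :=
  Real.iSup_le (fun i => le_ciSup (f := fun i : {i // i ≠ i₀} => lam i)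
    ⟨‖A‖, by rintro _ ⟨j, rfl⟩; exact lam_le_norm hb j⟩ ⟨i, i.2.1⟩) (Real.iSup_nonneg fun i => hlam i)

end FluxEnergy

end Literature.Analysis.OperatorTheory
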